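import Summits.ValiantsHypothesis.ValiantsHypothesis.Theorems.LacunarySymmetroidMatrixDescartesCensusDoorA34Box12IIII

/-!
# `MatrixDescartes` census — DOOR A at `(3,4)`: BOX13 COSTS EXACTLY FOURTEEN ALL-INDEFINITE ROWS AND FOUR RAIL END-WORDS

HONEST FRAMING.  Object-search cell `pub-symmetroid`; beside the OPEN typed statement `DoorA34 = PosRootLawAt 3 4 18`
(route item `Theses.LacunarySymmetroid.DoorA34`, stmt-ValiantsHypothesis-19980), asserted nowhere.  The first residue window of Door A at
`(3,4)` is the window of width `13` (`…CensusDoorA34Box`: BOX10 outright, `28` 3-Sidon supports with `d₃ ≤ 13` = `14` mirror pairs,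
`Census.sidon3_box13_enum`; `doorA34_box13_of_rows` priced it at `14` FULL rows).  Since then the tree acquired, on that window: the Descartes
layer, the singular-letter sector (`doorA34_on_singular_letter`), and engine-2's LP34 table replayed in the kernel (`…CensusLP34On<tag>`): on
`12` pairs EVERY definite-letter word is dead (`doorA34_on_<d>_of_definite_letter`), on the two RAIL pairs every position but one END letter is
dead (`(0,1,4,13)`: positions `0,1,2` dead, `3` alive; mirror `(0,9,12,13)`: `1,2,3` dead, `0` alive; `(0,3,4,13)`: `1,2,3` dead, `0` alive; mirror
`(0,9,10,13)`: `0,1,2` dead, `3` alive).  This file RE-PRICES BOX13 at exactly what no instrument of the cell reaches: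

* `allIndefinite_row_mirror` — the all-indefinite (`IIII`) row transfers to the mirror support (`x ↦ 1/x`, letters reversed: an `IIII` pencil stays `IIII`);
* `box13_sorted_of_residue_rows`, **`doorA34_box13_of_residue_rows`** — the window of width `13` of `DoorA34` (`PosRootLawOn 3 4 18 d` for every
  `d : Fin 4 → ℕ` with `d i ≤ d j + 13`) follows from: (a) the `IIII` ROW (every real symmetric pencil with four NONSINGULAR INDEFINITE letters has
  `≤ 18` distinct positive det-roots) on the `14` representative supports `(0,1,7,11)`, `(0,1,8,11)`, `(0,1,5,12)`, `(0,3,7,12)`, `(0,1,9,12)`,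
  `(0,2,9,12)`, `(0,1,4,13)`, `(0,3,4,13)`, `(0,2,7,13)`, `(0,5,7,13)`, `(0,1,8,13)`, `(0,2,8,13)`, `(0,1,10,13)`, `(0,2,10,13)`; and (b) the four
  ALIVE RAIL END-WORD rows: a definite TOP letter on `(0,1,4,13)` and on `(0,9,10,13)`, a definite BOTTOM letter on `(0,9,12,13)` and on `(0,3,4,13)`
  (engine-2 LP34-CERT §6: on the rail `(0,1,4,N)` the word `IIID` is alive in the relaxation — not known to be realisable).

Nothing here proves any residue row; `DoorA34` stays OPEN; nothing bears on `MatrixDescartes` (stmt-ValiantsHypothesis-18050) or `VP ≠ VNP`.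
[folklore] Assembly; elementary.
-/

-- `Summit.ValiantsHypothesis.ValiantsHypothesis.…` repeats a component by the D-0017 layout
-- (single-conjunct summit), which the `dupNamespace` linter flags; the name is mandated.
set_option linter.dupNamespace false

namespace Summit.ValiantsHypothesis.ValiantsHypothesis.Theorems.LacunarySymmetroidMatrixDescartes.Census

open Polynomial Finset
open scoped BigOperators Polynomial Matrix

/-- **The `IIII` row transfers to the mirror support.**  If every real symmetric pencil on `e` (`e l ≤ N`) with four nonsingular indefinite
letters has `≤ 18` distinct positive det-roots, the same holds on the mirror support `l ↦ N − e (rev l)`: the mirror pencil is the `x ↦ 1/x`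
reflection of a pencil on `e` with the letters reversed (`Census.card_posRoots_det_pencil_mirror`, `Census.pencil_comp_equiv`), still `IIII`. [folklore] -/
theorem allIndefinite_row_mirror (e : Fin 4 → ℕ) (N : ℕ) (he : ∀ l, e l ≤ N)
    (hrow : ∀ S : Fin 4 → Matrix (Fin 3) (Fin 3) ℝ, (∀ l, (S l).IsSymm) →
      (∀ l, (S l).det ≠ 0 ∧ ¬ (S l).PosDef ∧ ¬ (-S l).PosDef) →
      ((∑ k, ((X : ℝ[X]) ^ e k) • (S k).map C).det.roots.toFinset.filter (fun t => 0 < t)).card ≤ 18) :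
    ∀ S : Fin 4 → Matrix (Fin 3) (Fin 3) ℝ, (∀ l, (S l).IsSymm) →
      (∀ l, (S l).det ≠ 0 ∧ ¬ (S l).PosDef ∧ ¬ (-S l).PosDef) →
      ((∑ k, ((X : ℝ[X]) ^ (fun l => N - e (Fin.rev l)) k) • (S k).map C).det.roots.toFinset.filter (fun t => 0 < t)).card ≤ 18 := by
  intro S hS hI
  have key : (∑ k, ((X : ℝ[X]) ^ (fun l => N - e (Fin.rev l)) k) • (S k).map C)
      = ∑ k, (X : ℝ[X]) ^ (N - e k) • ((S ∘ Fin.rev) k).map C := by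
    rw [← pencil_comp_equiv Fin.revPerm (fun l => N - e l) (S ∘ Fin.rev)]
    refine Finset.sum_congr rfl fun k _ => ?_
    simp [Fin.revPerm_apply, Fin.rev_rev]
  rw [key, card_posRoots_det_pencil_mirror e N he (S ∘ Fin.rev)]
  exact hrow (S ∘ Fin.rev) (fun l => hS _) (fun l => hI _)

set_option maxHeartbeats 4000000 in
/-- **BOX13, sorted form, modulo the residue rows**: on a sorted 3-Sidon support `0 = e₀ < e₁ < e₂ < e₃ ≤ 13`, the fourteen `IIII` rows and the
four alive rail end-word rows imply `Z₊ ≤ 18` for EVERY real symmetric pencil on `e` (singular sector + LP34 rows of record for the rest). [folklore] -/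
theorem box13_sorted_of_residue_rows
    (hIIII : ∀ e : Fin 4 → ℕ, e ∈ ([![0, 1, 7, 11], ![0, 1, 8, 11], ![0, 1, 5, 12], ![0, 3, 7, 12], ![0, 1, 9, 12], ![0, 2, 9, 12], ![0, 1, 4, 13],
        ![0, 3, 4, 13], ![0, 2, 7, 13], ![0, 5, 7, 13], ![0, 1, 8, 13], ![0, 2, 8, 13], ![0, 1, 10, 13], ![0, 2, 10, 13]] : List (Fin 4 → ℕ)) →
      ∀ S : Fin 4 → Matrix (Fin 3) (Fin 3) ℝ, (∀ l, (S l).IsSymm) →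
        (∀ l, (S l).det ≠ 0 ∧ ¬ (S l).PosDef ∧ ¬ (-S l).PosDef) →
        ((∑ k, ((X : ℝ[X]) ^ e k) • (S k).map C).det.roots.toFinset.filter (fun t => 0 < t)).card ≤ 18)
    (hTop_0_1_4_13 : ∀ S : Fin 4 → Matrix (Fin 3) (Fin 3) ℝ, (∀ l, (S l).IsSymm) → ((S 3).PosDef ∨ (-S 3).PosDef) →
      ((∑ k, ((X : ℝ[X]) ^ (![0, 1, 4, 13] : Fin 4 → ℕ) k) • (S k).map C).det.roots.toFinset.filter (fun t => 0 < t)).card ≤ 18)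
    (hBot_0_9_12_13 : ∀ S : Fin 4 → Matrix (Fin 3) (Fin 3) ℝ, (∀ l, (S l).IsSymm) → ((S 0).PosDef ∨ (-S 0).PosDef) →
      ((∑ k, ((X : ℝ[X]) ^ (![0, 9, 12, 13] : Fin 4 → ℕ) k) • (S k).map C).det.roots.toFinset.filter (fun t => 0 < t)).card ≤ 18)
    (hBot_0_3_4_13 : ∀ S : Fin 4 → Matrix (Fin 3) (Fin 3) ℝ, (∀ l, (S l).IsSymm) → ((S 0).PosDef ∨ (-S 0).PosDef) →
      ((∑ k, ((X : ℝ[X]) ^ (![0, 3, 4, 13] : Fin 4 → ℕ) k) • (S k).map C).det.roots.toFinset.filter (fun t => 0 < t)).card ≤ 18)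
    (hTop_0_9_10_13 : ∀ S : Fin 4 → Matrix (Fin 3) (Fin 3) ℝ, (∀ l, (S l).IsSymm) → ((S 3).PosDef ∨ (-S 3).PosDef) →
      ((∑ k, ((X : ℝ[X]) ^ (![0, 9, 10, 13] : Fin 4 → ℕ) k) • (S k).map C).det.roots.toFinset.filter (fun t => 0 < t)).card ≤ 18)
    (e : Fin 4 → ℕ) (he : StrictMono e) (he0 : e 0 = 0) (he3 : e 3 ≤ 13)
    (h20 : 20 ≤ ((Finset.univ : Finset (Fin 4 × Fin 4 × Fin 4)).image (fun p => e p.1 + e p.2.1 + e p.2.2)).card) :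
    PosRootLawOn 3 4 18 e := by
  have hv : e = (![0, e 1, e 2, e 3] : Fin 4 → ℕ) := by
    funext k; fin_cases k <;> simp [he0]
  have h1 : 0 < e 1 := by have := he (show (0 : Fin 4) < 1 by decide); omega
  have h20' : 20 ≤ ((Finset.univ : Finset (Fin 4 × Fin 4 × Fin 4)).image (fun p => (![0, e 1, e 2, e 3] : Fin 4 → ℕ) p.1 +
      (![0, e 1, e 2, e 3] : Fin 4 → ℕ) p.2.1 + (![0, e 1, e 2, e 3] : Fin 4 → ℕ) p.2.2)).card := by
    rw [← hv]; exact h20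
  have hmem := sidon3_box13_enum (e 3) (List.mem_range.2 (by omega)) (e 2) (List.mem_range.2 (he (by decide)))
    (e 1) (List.mem_range.2 (he (by decide))) h1 h20'
  rw [hv]
  simp only [List.mem_cons, List.mem_nil_iff, or_false] at hmem
  rcases hmem with h | h | h | h | h | h | h | h | h | h | h | h | h | h | h | h | h | h | h | h | h | h | h | h | h | h | h | h
  · rw [h]
    refine doorA34_on_of_sectors _ (fun S hS hdef => doorA34_on_0_1_7_11_of_definite_letter S hS hdef) ?_
    exact hIIII _ (by simp)
  · rw [h]
    refine doorA34_on_of_sectors _ (fun S hS hdef => doorA34_on_0_1_8_11_of_definite_letter S hS hdef) ?_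
    exact hIIII _ (by simp)
  · rw [h]
    refine doorA34_on_of_sectors _ (fun S hS hdef => doorA34_on_0_3_10_11_of_definite_letter S hS hdef) ?_
    have hm := allIndefinite_row_mirror (![0, 1, 8, 11] : Fin 4 → ℕ) 11 (by decide) (hIIII _ (by simp))
    have em : (fun l : Fin 4 => 11 - (![0, 1, 8, 11] : Fin 4 → ℕ) (Fin.rev l)) = (![0, 3, 10, 11] : Fin 4 → ℕ) := by decide
    rw [em] at hm
    exact hm
  · rw [h]
    refine doorA34_on_of_sectors _ (fun S hS hdef => doorA34_on_0_4_10_11_of_definite_letter S hS hdef) ?_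
    have hm := allIndefinite_row_mirror (![0, 1, 7, 11] : Fin 4 → ℕ) 11 (by decide) (hIIII _ (by simp))
    have em : (fun l : Fin 4 => 11 - (![0, 1, 7, 11] : Fin 4 → ℕ) (Fin.rev l)) = (![0, 4, 10, 11] : Fin 4 → ℕ) := by decide
    rw [em] at hm
    exact hm
  · rw [h]
    refine doorA34_on_of_sectors _ (fun S hS hdef => doorA34_on_0_1_5_12_of_definite_letter S hS hdef) ?_
    exact hIIII _ (by simp)
  · rw [h]
    refine doorA34_on_of_sectors _ (fun S hS hdef => doorA34_on_0_3_7_12_of_definite_letter S hS hdef) ?_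
    exact hIIII _ (by simp)
  · rw [h]
    refine doorA34_on_of_sectors _ (fun S hS hdef => doorA34_on_0_1_9_12_of_definite_letter S hS hdef) ?_
    exact hIIII _ (by simp)
  · rw [h]
    refine doorA34_on_of_sectors _ (fun S hS hdef => doorA34_on_0_2_9_12_of_definite_letter S hS hdef) ?_
    exact hIIII _ (by simp)
  · rw [h]
    refine doorA34_on_of_sectors _ (fun S hS hdef => doorA34_on_0_5_9_12_of_definite_letter S hS hdef) ?_
    have hm := allIndefinite_row_mirror (![0, 3, 7, 12] : Fin 4 → ℕ) 12 (by decide) (hIIII _ (by simp))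
    have em : (fun l : Fin 4 => 12 - (![0, 3, 7, 12] : Fin 4 → ℕ) (Fin.rev l)) = (![0, 5, 9, 12] : Fin 4 → ℕ) := by decide
    rw [em] at hm
    exact hm
  · rw [h]
    refine doorA34_on_of_sectors _ (fun S hS hdef => doorA34_on_0_3_10_12_of_definite_letter S hS hdef) ?_
    have hm := allIndefinite_row_mirror (![0, 2, 9, 12] : Fin 4 → ℕ) 12 (by decide) (hIIII _ (by simp))
    have em : (fun l : Fin 4 => 12 - (![0, 2, 9, 12] : Fin 4 → ℕ) (Fin.rev l)) = (![0, 3, 10, 12] : Fin 4 → ℕ) := by decide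
    rw [em] at hm
    exact hm
  · rw [h]
    refine doorA34_on_of_sectors _ (fun S hS hdef => doorA34_on_0_3_11_12_of_definite_letter S hS hdef) ?_
    have hm := allIndefinite_row_mirror (![0, 1, 9, 12] : Fin 4 → ℕ) 12 (by decide) (hIIII _ (by simp))
    have em : (fun l : Fin 4 => 12 - (![0, 1, 9, 12] : Fin 4 → ℕ) (Fin.rev l)) = (![0, 3, 11, 12] : Fin 4 → ℕ) := by decide
    rw [em] at hm
    exact hm
  · rw [h]
    refine doorA34_on_of_sectors _ (fun S hS hdef => doorA34_on_0_7_11_12_of_definite_letter S hS hdef) ?_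
    have hm := allIndefinite_row_mirror (![0, 1, 5, 12] : Fin 4 → ℕ) 12 (by decide) (hIIII _ (by simp))
    have em : (fun l : Fin 4 => 12 - (![0, 1, 5, 12] : Fin 4 → ℕ) (Fin.rev l)) = (![0, 7, 11, 12] : Fin 4 → ℕ) := by decide
    rw [em] at hm
    exact hm
  · rw [h]
    refine doorA34_on_of_sectors _ (fun S hS hdef => ?_) ?_
    · obtain ⟨l, hl⟩ := hdef
      fin_cases l
      · exact doorA34_on_0_1_4_13_of_definite_0 S hS hl
      · exact doorA34_on_0_1_4_13_of_definite_1 S hS hl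
      · exact doorA34_on_0_1_4_13_of_definite_2 S hS hl
      · exact hTop_0_1_4_13 S hS hl
    · exact hIIII _ (by simp)
  · rw [h]
    refine doorA34_on_of_sectors _ (fun S hS hdef => ?_) ?_
    · obtain ⟨l, hl⟩ := hdef
      fin_cases l
      · exact hBot_0_3_4_13 S hS hl
      · exact doorA34_on_0_3_4_13_of_definite_1 S hS hl
      · exact doorA34_on_0_3_4_13_of_definite_2 S hS hl
      · exact doorA34_on_0_3_4_13_of_definite_3 S hS hl
    · exact hIIII _ (by simp)
  · rw [h]
    refine doorA34_on_of_sectors _ (fun S hS hdef => doorA34_on_0_2_7_13_of_definite_letter S hS hdef) ?_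
    exact hIIII _ (by simp)
  · rw [h]
    refine doorA34_on_of_sectors _ (fun S hS hdef => doorA34_on_0_5_7_13_of_definite_letter S hS hdef) ?_
    exact hIIII _ (by simp)
  · rw [h]
    refine doorA34_on_of_sectors _ (fun S hS hdef => doorA34_on_0_1_8_13_of_definite_letter S hS hdef) ?_
    exact hIIII _ (by simp)
  · rw [h]
    refine doorA34_on_of_sectors _ (fun S hS hdef => doorA34_on_0_2_8_13_of_definite_letter S hS hdef) ?_
    exact hIIII _ (by simp)
  · rw [h]
    refine doorA34_on_of_sectors _ (fun S hS hdef => doorA34_on_0_6_8_13_of_definite_letter S hS hdef) ?_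
    have hm := allIndefinite_row_mirror (![0, 5, 7, 13] : Fin 4 → ℕ) 13 (by decide) (hIIII _ (by simp))
    have em : (fun l : Fin 4 => 13 - (![0, 5, 7, 13] : Fin 4 → ℕ) (Fin.rev l)) = (![0, 6, 8, 13] : Fin 4 → ℕ) := by decide
    rw [em] at hm
    exact hm
  · rw [h]
    refine doorA34_on_of_sectors _ (fun S hS hdef => doorA34_on_0_1_10_13_of_definite_letter S hS hdef) ?_
    exact hIIII _ (by simp)
  · rw [h]
    refine doorA34_on_of_sectors _ (fun S hS hdef => doorA34_on_0_2_10_13_of_definite_letter S hS hdef) ?_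
    exact hIIII _ (by simp)
  · rw [h]
    refine doorA34_on_of_sectors _ (fun S hS hdef => ?_) ?_
    · obtain ⟨l, hl⟩ := hdef
      fin_cases l
      · exact doorA34_on_0_9_10_13_of_definite_0 S hS hl
      · exact doorA34_on_0_9_10_13_of_definite_1 S hS hl
      · exact doorA34_on_0_9_10_13_of_definite_2 S hS hl
      · exact hTop_0_9_10_13 S hS hl
    · have hm := allIndefinite_row_mirror (![0, 3, 4, 13] : Fin 4 → ℕ) 13 (by decide) (hIIII _ (by simp))
      have em : (fun l : Fin 4 => 13 - (![0, 3, 4, 13] : Fin 4 → ℕ) (Fin.rev l)) = (![0, 9, 10, 13] : Fin 4 → ℕ) := by decide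
      rw [em] at hm
      exact hm
  · rw [h]
    refine doorA34_on_of_sectors _ (fun S hS hdef => doorA34_on_0_3_11_13_of_definite_letter S hS hdef) ?_
    have hm := allIndefinite_row_mirror (![0, 2, 10, 13] : Fin 4 → ℕ) 13 (by decide) (hIIII _ (by simp))
    have em : (fun l : Fin 4 => 13 - (![0, 2, 10, 13] : Fin 4 → ℕ) (Fin.rev l)) = (![0, 3, 11, 13] : Fin 4 → ℕ) := by decide
    rw [em] at hm
    exact hm
  · rw [h]
    refine doorA34_on_of_sectors _ (fun S hS hdef => doorA34_on_0_5_11_13_of_definite_letter S hS hdef) ?_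
    have hm := allIndefinite_row_mirror (![0, 2, 8, 13] : Fin 4 → ℕ) 13 (by decide) (hIIII _ (by simp))
    have em : (fun l : Fin 4 => 13 - (![0, 2, 8, 13] : Fin 4 → ℕ) (Fin.rev l)) = (![0, 5, 11, 13] : Fin 4 → ℕ) := by decide
    rw [em] at hm
    exact hm
  · rw [h]
    refine doorA34_on_of_sectors _ (fun S hS hdef => doorA34_on_0_6_11_13_of_definite_letter S hS hdef) ?_
    have hm := allIndefinite_row_mirror (![0, 2, 7, 13] : Fin 4 → ℕ) 13 (by decide) (hIIII _ (by simp))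
    have em : (fun l : Fin 4 => 13 - (![0, 2, 7, 13] : Fin 4 → ℕ) (Fin.rev l)) = (![0, 6, 11, 13] : Fin 4 → ℕ) := by decide
    rw [em] at hm
    exact hm
  · rw [h]
    refine doorA34_on_of_sectors _ (fun S hS hdef => doorA34_on_0_3_12_13_of_definite_letter S hS hdef) ?_
    have hm := allIndefinite_row_mirror (![0, 1, 10, 13] : Fin 4 → ℕ) 13 (by decide) (hIIII _ (by simp))
    have em : (fun l : Fin 4 => 13 - (![0, 1, 10, 13] : Fin 4 → ℕ) (Fin.rev l)) = (![0, 3, 12, 13] : Fin 4 → ℕ) := by decide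
    rw [em] at hm
    exact hm
  · rw [h]
    refine doorA34_on_of_sectors _ (fun S hS hdef => doorA34_on_0_5_12_13_of_definite_letter S hS hdef) ?_
    have hm := allIndefinite_row_mirror (![0, 1, 8, 13] : Fin 4 → ℕ) 13 (by decide) (hIIII _ (by simp))
    have em : (fun l : Fin 4 => 13 - (![0, 1, 8, 13] : Fin 4 → ℕ) (Fin.rev l)) = (![0, 5, 12, 13] : Fin 4 → ℕ) := by decide
    rw [em] at hm
    exact hm
  · rw [h]
    refine doorA34_on_of_sectors _ (fun S hS hdef => ?_) ?_
    · obtain ⟨l, hl⟩ := hdef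
      fin_cases l
      · exact hBot_0_9_12_13 S hS hl
      · exact doorA34_on_0_9_12_13_of_definite_1 S hS hl
      · exact doorA34_on_0_9_12_13_of_definite_2 S hS hl
      · exact doorA34_on_0_9_12_13_of_definite_3 S hS hl
    · have hm := allIndefinite_row_mirror (![0, 1, 4, 13] : Fin 4 → ℕ) 13 (by decide) (hIIII _ (by simp))
      have em : (fun l : Fin 4 => 13 - (![0, 1, 4, 13] : Fin 4 → ℕ) (Fin.rev l)) = (![0, 9, 12, 13] : Fin 4 → ℕ) := by decide
      rw [em] at hm
      exact hm

/-- **BOX13 ⟸ FOURTEEN `IIII` ROWS + FOUR RAIL END-WORDS.**  Suppose (a) on each of the fourteen representative sorted 3-Sidon supports of width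
`11 ≤ d₃ ≤ 13` every real symmetric `3 × 3` pencil whose four letters are all NONSINGULAR and INDEFINITE has at most `18` distinct positive
det-roots, and (b) the four alive rail end-words are dead too: a (positive or negative) definite TOP letter on `(0,1,4,13)` and on `(0,9,10,13)`, a
definite BOTTOM letter on `(0,9,12,13)` and on `(0,3,4,13)` each force `≤ 18`.  Then `ζ(3,4; d) ≤ 18` for EVERY exponent vector `d` with
`d i ≤ d j + 13` — everything else on the window (repeated / non-Sidon exponents, singular letters, the other `416` definite-letter chambers, the
mirrors) is in the tree. [folklore] -/
theorem doorA34_box13_of_residue_rows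
    (hIIII : ∀ e : Fin 4 → ℕ, e ∈ ([![0, 1, 7, 11], ![0, 1, 8, 11], ![0, 1, 5, 12], ![0, 3, 7, 12], ![0, 1, 9, 12], ![0, 2, 9, 12], ![0, 1, 4, 13],
        ![0, 3, 4, 13], ![0, 2, 7, 13], ![0, 5, 7, 13], ![0, 1, 8, 13], ![0, 2, 8, 13], ![0, 1, 10, 13], ![0, 2, 10, 13]] : List (Fin 4 → ℕ)) →
      ∀ S : Fin 4 → Matrix (Fin 3) (Fin 3) ℝ, (∀ l, (S l).IsSymm) →
        (∀ l, (S l).det ≠ 0 ∧ ¬ (S l).PosDef ∧ ¬ (-S l).PosDef) →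
        ((∑ k, ((X : ℝ[X]) ^ e k) • (S k).map C).det.roots.toFinset.filter (fun t => 0 < t)).card ≤ 18)
    (hTop_0_1_4_13 : ∀ S : Fin 4 → Matrix (Fin 3) (Fin 3) ℝ, (∀ l, (S l).IsSymm) → ((S 3).PosDef ∨ (-S 3).PosDef) →
      ((∑ k, ((X : ℝ[X]) ^ (![0, 1, 4, 13] : Fin 4 → ℕ) k) • (S k).map C).det.roots.toFinset.filter (fun t => 0 < t)).card ≤ 18)
    (hBot_0_9_12_13 : ∀ S : Fin 4 → Matrix (Fin 3) (Fin 3) ℝ, (∀ l, (S l).IsSymm) → ((S 0).PosDef ∨ (-S 0).PosDef) →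
      ((∑ k, ((X : ℝ[X]) ^ (![0, 9, 12, 13] : Fin 4 → ℕ) k) • (S k).map C).det.roots.toFinset.filter (fun t => 0 < t)).card ≤ 18)
    (hBot_0_3_4_13 : ∀ S : Fin 4 → Matrix (Fin 3) (Fin 3) ℝ, (∀ l, (S l).IsSymm) → ((S 0).PosDef ∨ (-S 0).PosDef) →
      ((∑ k, ((X : ℝ[X]) ^ (![0, 3, 4, 13] : Fin 4 → ℕ) k) • (S k).map C).det.roots.toFinset.filter (fun t => 0 < t)).card ≤ 18)
    (hTop_0_9_10_13 : ∀ S : Fin 4 → Matrix (Fin 3) (Fin 3) ℝ, (∀ l, (S l).IsSymm) → ((S 3).PosDef ∨ (-S 3).PosDef) →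
      ((∑ k, ((X : ℝ[X]) ^ (![0, 9, 10, 13] : Fin 4 → ℕ) k) • (S k).map C).det.roots.toFinset.filter (fun t => 0 < t)).card ≤ 18)
    (d : Fin 4 → ℕ) (hw : ∀ i j, d i ≤ d j + 13) : PosRootLawOn 3 4 18 d :=
  doorA34_box_of_sidonRows 13 (fun e he he0 he3 h20 =>
    box13_sorted_of_residue_rows hIIII hTop_0_1_4_13 hBot_0_9_12_13 hBot_0_3_4_13 hTop_0_9_10_13 e he he0 he3 h20) d hw

end Summit.ValiantsHypothesis.ValiantsHypothesis.Theorems.LacunarySymmetroidMatrixDescartes.Census
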